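import Mathlib

/-!
# Beta/MomentFactorisation — moments of lattice convolutions: the (1.22) second moment of a DRESSED kernel
`h ⋆ T ⋆ h′` sees the dressing kernels only through their zeroth moments once `T` has vanishing zeroth and first moments

HONEST FRAMING (cell `pub-balaban`, β sub-cell, row an2 = the background-field / log-det route; HOME/BETA/AN2.md §10.12).
The β sub-cell tries to discharge the one-loop input `FlowStep.BetaPertH` of [Balaban1987RG1] Theorem 2; discharging it
would make Bałaban's ultraviolet STABILITY theorem unconditional — a constructive-QFT statement that is NOT the continuum
limit and NOT the Clay problem — and this file is not even that: it is the elementary moment algebra of finitely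
supported lattice functions under convolution.  Value = kernel certificate of a structural step, NOT summit progress.

WHAT IS IN PRINT (context, cited by number; the manuscripts are the object of the audit and are not used as facts).
[Balaban1987RG1] p. 264: «Let us denote E^{(j+1)}(g_j, B) = E^{(j+1)}(g_j, U_{j+1}(exp iB)). We define
Π^{ab}_{j+1,μν}(g_j, x, x′) = (δ²/δB^a_μ(x)δB^b_ν(x′) E^{(j+1)})(g_j, 0). (1.20)» — the polarization tensor is the
second derivative of the effective-action term COMPOSED WITH THE BACKGROUND-FIELD (minimizer) MAP `B ↦ U_{j+1}(exp iB)`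
from unit-lattice fields `B` on `T^{(j+1)}` to fine-lattice configurations; (1.21) «Π^{ab}_{j+1,μν}(g_j,x,x′) =
δ^{ab}Π_{j+1,μν}(g_j, x − x′)»; «Now we take a limit of these functions as T^{(j+1)} ↗ Z^d»; (1.22)
«β_{j+1}(g_j) = … = Σ_x Π_{j+1,μν}(g_j, x)x_μx_ν for μ, ν arbitrary, μ ≠ ν».  P. 282 [PDF 34], lines 1–2 (before
(4.5)): «The functional derivative (δ^{n(p)})/(δB^{n(p)})H_j(□₀, 0) is given by a sum of several perturbative expressions
discussed in Sect. G [15]. Each expression corresponds to a tree graph with n(p) initial points and one final point,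
and it has an exponential decay in a length of this graph.», [15] = [Balaban1985Variational] (the variational problem
and background fields; its (189)–(190), p. 308, state the exponential localization of δ𝓗(B)/δB, the derivation of
(189) being declared omitted there).  By the chain rule the
second derivative of `F ∘ U` at `0` is `F″(U(0))[U′·, U′·] + F′(U(0))∘U″`; when the fine-level Hessian kernel `T` of `F`
and the linear response `j = U′(0)` are invariant under unit-lattice translations, the first term is, as a function of
`x′ − x`, the DOUBLE CONVOLUTION `jᵀ ⋆ T ⋆ ǰ` (`ǰ(a) = j(−a)`) — a dressing of `T` by the minimizer's response kernels.
This file records what such a dressing does to the moments entering (1.22).  The tree's `B12Beta.secondMoment`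
([Balaban1987RG1] (1.22) as a `tsum` over `ℤ^d`) is linked for finitely supported real kernels in §4.

WHAT THIS FILE PROVES (all `[folklore]`; lattice `Fin d → ℤ`, values in a ring `R`, NOT assumed commutative so that
matrix-valued kernels — internal indices `𝔤 ⊗ directions ⊗ block positions` — are covered; functions of FINITE support,
`(Fin d → ℤ) →₀ R`):
* §1 `conv f g = Σ_{x,y} δ_{x+y}·(f x · g y)` (the convolution — the same double-sum formula as the multiplication of the additive monoid algebra `AddMonoidAlgebra R (Fin d → ℤ)`),
  `moment φ f = Σ_x φ(x)•f(x)` for an integer weight `φ`, and `M0`, `M1 μ`, `M2 μ ν` (weights `1`, `x_μ`, `x_μx_ν`);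
* §2 `moment_conv` (the double-sum form) and the LEIBNIZ RULES `M0_conv : M0(f⋆g) = M0 f · M0 g`,
  `M1_conv : M1_μ(f⋆g) = M1_μ f · M0 g + M0 f · M1_μ g`,
  `M2_conv : M2_{μν}(f⋆g) = M2_{μν} f · M0 g + M1_μ f · M1_ν g + M1_ν f · M1_μ g + M0 f · M2_{μν} g`
  (= the derivatives at `p = 0` of a product of Fourier transforms, done on the lattice side);
* §3 `reflect f (x) = f(−x)` with `M0_reflect`, `M1_reflect` (sign flip), `M2_reflect`; `M2_conv_of_vanishing` (one-sided
  dressing); `M0_dressed`, `M1_dressed`; THE DRESSING IDENTITIES for `h ⋆ T ⋆ h′`: `M2_dressed_nine` (all nine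
  distributions of the two weights among the three factors, factor ORDER kept), `M2_dressed_ward` (under the WARD-TYPE
  hypotheses `M0 h · M0 T = 0 = M0 T · M0 h′` only: MAIN TERM `M0 h · M2 T · M0 h′` + four `M1 T`-cross terms + two
  `M0 T`-terms pairing first moments of both dressing kernels — in Fourier language `ĵ₀*T̂₂ĵ₀ + (ĵ₀*T̂₁ĵ₁ + ĵ₁*T̂₁ĵ₀) +
  ĵ₁*T̂₀ĵ₁`), and the fully factorised case `M2_dressed` (if `M0 T = 0` and `M1_μ T = M1_ν T = 0` OUTRIGHT then
  `M2_{μν}(h ⋆ T ⋆ h′) = M0 h · M2_{μν} T · M0 h′`; `M2_dressed_of_unit`: unchanged when `M0 h = M0 h′ = 1`);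
* §4 (`R = ℝ`) `secondMoment_eq_M2`: for a finitely supported real kernel the tree's (1.22) `tsum`
  `B12Beta.secondMoment` IS `M2` (so §3 is a statement about the printed second moment for such kernels).

HOW IT IS MEANT TO BE USED (row an2, AN2.md §10.11–10.12; nothing of it is asserted here).  In the background-field
route the one-loop pieces are functions of the FINE background `U₀`, and (1.20) differentiates them THROUGH the
minimizer map; with the internal index = (fine position in a unit block) × direction × colour, `T` and `j` are
MATRIX-valued unit-lattice kernels and their moments are matrices.  What gauge invariance gives at the fine level is
that `T` annihilates CONSTANT fine one-forms (the zero-momentum Ward identity, row an2 item (iv)), and what the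
variational problem gives is that the zeroth moment `M0 j` of the response is such a block-constant pattern (constants
are reproduced by the block averages) — i.e. exactly the WARD-TYPE hypotheses of `M2_dressed_ward`, NOT `M0 T = 0` as a
matrix.  So the honest reading of §3 for the (1.22) second moment of the dressed kernel is the SEVEN-TERM identity
`M2_dressed_ward`: the U-level second moment `M0 jᵀ · M2 T · M0 ǰ` PLUS six intra-block cross terms (first moments of
the minimizer response against `M0 T`, `M1 T` on block-periodic patterns), each a finite object at one unit scale
whose k-uniformity is a decay statement about the minimizer kernels ([Balaban1987RG1] p. 282 ll. 1–2 →
[Balaban1985Variational] Sect. G (189)–(190), printed-asserted) — typed in AN2.md §10.12, not proved anywhere in the tree.  The fully factorised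
`M2_dressed` applies only where `M0 T` and `M1 T` vanish outright (e.g. after reduction to block-constant patterns, or
for a kernel with trivial internal space).  WHAT THIS DOES NOT COVER: the second chain-rule term `F′(U₀)∘U″`; kernels
of infinite support (Bałaban's `j`, `T` decay exponentially on `ℤ^d`; the identities extend to absolutely summable
families with finite second moments by dominated convergence — routine, not done here); the WINDOW sums of the
sub-cell wall at finite `L` (only full moments obey these identities exactly); any identification of `T`, `j` with
Bałaban's operators; any value of `M0 j`.  NOT summit progress; NOT continuum, NOT Clay.

References: T. Bałaban, Commun. Math. Phys. 109 (1987) 249–301 [Balaban1987RG1] ((1.20)–(1.22) p. 264; p. 282 ll. 1–2);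
T. Bałaban, Commun. Math. Phys. 102 (1985) 277–309 [Balaban1985Variational] (Sect. G: derivatives of the minimizers).
Unit `b2b-balaban-beta-an2-g3` (BETA cell, row an2, gen 3), journal claim BETA-an2-MOMENT; v1 p180941 (dc23b613f06d); v1.1 p180976 (6611f0dc1534) = v1 +
`M2_dressed_nine`, `M2_dressed_ward` and the honest HOW-IT-IS-MEANT-TO-BE-USED paragraph (v1's declarations unchanged); v1.1.1 =
DOCFIX (this docstring only: the p. 282 locator «lines 1–2, before (4.5)» quoted verbatim, per REFEREE-BETA v21); staged
byte-identically under `HOME/lean/BalabanYm4/`.  NOT summit progress.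
-/

namespace Literature.MathematicalPhysics.QuantumFieldTheory.Balaban1983to89.Beta.MomentFactorisation

open Finsupp

variable {d : ℕ} {R : Type*} [Ring R]

/-! ## §1 Convolution and moments of finitely supported lattice functions -/

/-- Finitely supported functions on the lattice `ℤ^d = Fin d → ℤ` with values in `R`. [folklore] -/
abbrev LatFun (d : ℕ) (R : Type*) [Ring R] : Type _ := (Fin d → ℤ) →₀ R

/-- Convolution `(f ⋆ g)(z) = Σ_{x+y=z} f(x)·g(y)` (values of `f` on the LEFT, of `g` on the RIGHT; `R` may be
noncommutative) — the same double-sum formula as the multiplication of the additive monoid algebra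
`AddMonoidAlgebra R (Fin d → ℤ)`. [folklore] -/
noncomputable def conv (f g : LatFun d R) : LatFun d R :=
  f.sum fun x a => g.sum fun y b => Finsupp.single (x + y) (a * b)

/-- The `φ`-moment `Σ_x φ(x) • f(x)` of a finitely supported lattice function, for an integer weight `φ`. [folklore] -/
def moment (φ : (Fin d → ℤ) → ℤ) (f : LatFun d R) : R :=
  f.sum fun x a => φ x • a

/-- Zeroth moment `Σ_x f(x)` (the value of the Fourier transform at `p = 0`). [folklore] -/
def M0 (f : LatFun d R) : R := moment (fun _ => 1) f

/-- First moment `Σ_x x_μ • f(x)`. [folklore] -/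
def M1 (μ : Fin d) (f : LatFun d R) : R := moment (fun x => x μ) f

/-- Second moment `Σ_x (x_μ x_ν) • f(x)` — the shape of [Balaban1987RG1] (1.22). [folklore] -/
def M2 (μ ν : Fin d) (f : LatFun d R) : R := moment (fun x => x μ * x ν) f

omit [Ring R] in
/-- `moment` is additive in the weight. [folklore] -/
theorem moment_add_weight [Ring R] (φ ψ : (Fin d → ℤ) → ℤ) (f : LatFun d R) :
    moment (fun x => φ x + ψ x) f = moment φ f + moment ψ f := by
  simp only [moment, add_smul, Finsupp.sum_add]

/-! ## §2 Moments of a convolution: the Leibniz rules -/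

/-- The `φ`-moment of a convolution as a double sum: `Σ_{x,y} φ(x + y) • (f x · g y)`. [folklore] -/
theorem moment_conv (φ : (Fin d → ℤ) → ℤ) (f g : LatFun d R) :
    moment φ (conv f g) = f.sum fun x a => g.sum fun y b => φ (x + y) • (a * b) := by
  unfold moment conv
  rw [Finsupp.sum_sum_index (fun _ => smul_zero _) (fun _ _ _ => smul_add _ _ _)]
  apply Finsupp.sum_congr
  intro x _
  rw [Finsupp.sum_sum_index (fun _ => smul_zero _) (fun _ _ _ => smul_add _ _ _)]
  apply Finsupp.sum_congr
  intro y _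
  exact Finsupp.sum_single_index (smul_zero _)

omit [Ring R] in
/-- The moment of a point mass. [folklore] -/
theorem moment_single [Ring R] (φ : (Fin d → ℤ) → ℤ) (x : Fin d → ℤ) (a : R) :
    moment φ (Finsupp.single x a) = φ x • a :=
  Finsupp.sum_single_index (smul_zero _)

omit [Ring R] in
/-- `moment φ 0 = 0`. [folklore] -/
theorem moment_zero [Ring R] (φ : (Fin d → ℤ) → ℤ) : moment φ (0 : LatFun d R) = 0 :=
  Finsupp.sum_zero_index

omit [Ring R] in
/-- Moments are additive in the function. [folklore] -/
theorem moment_add [Ring R] (φ : (Fin d → ℤ) → ℤ) (f g : LatFun d R) :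
    moment φ (f + g) = moment φ f + moment φ g :=
  Finsupp.sum_add_index' (fun _ => smul_zero _) (fun _ _ _ => smul_add _ _ _)

omit [Ring R] in
/-- Moments of a negative. [folklore] -/
theorem moment_neg [Ring R] (φ : (Fin d → ℤ) → ℤ) (f : LatFun d R) : moment φ (-f) = -moment φ f := by
  have h := moment_add φ (-f) f
  rw [neg_add_cancel, moment_zero] at h
  exact eq_neg_of_add_eq_zero_left h.symm

omit [Ring R] in
/-- Moments of a difference. [folklore] -/
theorem moment_sub [Ring R] (φ : (Fin d → ℤ) → ℤ) (f g : LatFun d R) :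
    moment φ (f - g) = moment φ f - moment φ g := by
  rw [sub_eq_add_neg, moment_add, moment_neg, ← sub_eq_add_neg]

/-- **Leibniz rule, order 0**: `M0 (f ⋆ g) = M0 f · M0 g`. [folklore] -/
theorem M0_conv (f g : LatFun d R) : M0 (conv f g) = M0 f * M0 g := by
  unfold M0
  rw [moment_conv]
  simp only [moment, one_smul]
  rw [Finsupp.sum_mul]
  apply Finsupp.sum_congr
  intro x _
  rw [Finsupp.mul_sum]

/-- The elementary rearrangement `(m·n) • (a·b) = (m • a)·(n • b)` for integer weights. [folklore] -/
theorem mul_smul_mul (m n : ℤ) (a b : R) : (m * n) • (a * b) = (m • a) * (n • b) := by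
  rw [smul_mul_smul_comm]

/-- **Leibniz rule, order 1**: `M1_μ (f ⋆ g) = M1_μ f · M0 g + M0 f · M1_μ g`. [folklore] -/
theorem M1_conv (μ : Fin d) (f g : LatFun d R) : M1 μ (conv f g) = M1 μ f * M0 g + M0 f * M1 μ g := by
  unfold M1 M0
  rw [moment_conv]
  simp only [moment, one_smul, Pi.add_apply, add_smul, Finsupp.sum_add]
  congr 1
  · rw [Finsupp.sum_mul]
    apply Finsupp.sum_congr
    intro x _
    rw [Finsupp.mul_sum]
    apply Finsupp.sum_congr
    intro y _
    rw [smul_mul_assoc]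
  · rw [Finsupp.sum_mul]
    apply Finsupp.sum_congr
    intro x _
    rw [Finsupp.mul_sum]
    apply Finsupp.sum_congr
    intro y _
    rw [mul_smul_comm]

/-- **Leibniz rule, order 2**:
`M2_{μν} (f ⋆ g) = M2_{μν} f · M0 g + M1_μ f · M1_ν g + M1_ν f · M1_μ g + M0 f · M2_{μν} g`. [folklore] -/
theorem M2_conv (μ ν : Fin d) (f g : LatFun d R) :
    M2 μ ν (conv f g) = M2 μ ν f * M0 g + M1 μ f * M1 ν g + M1 ν f * M1 μ g + M0 f * M2 μ ν g := by
  have key : ∀ (x y : Fin d → ℤ) (a b : R),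
      ((x + y) μ * (x + y) ν) • (a * b) =
        ((x μ * x ν) • a) * b + (x μ • a) * (y ν • b) + (x ν • a) * (y μ • b) + a * ((y μ * y ν) • b) := by
    intro x y a b
    simp only [Pi.add_apply]
    have h : (x μ + y μ) * (x ν + y ν) = x μ * x ν + x μ * y ν + x ν * y μ + y μ * y ν := by ring
    rw [h, add_smul, add_smul, add_smul, smul_mul_assoc, ← mul_smul_mul, ← mul_smul_mul, mul_smul_comm]
  unfold M2 M1 M0
  rw [moment_conv]
  simp only [moment, one_smul]
  simp only [key, Finsupp.sum_add]
  have e1 : (f.sum fun x a => g.sum fun y b => ((x μ * x ν) • a) * b) =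
      (f.sum fun x a => (x μ * x ν) • a) * g.sum fun y b => b := by
    rw [Finsupp.sum_mul]; apply Finsupp.sum_congr; intro x _; rw [Finsupp.mul_sum]
  have e2 : (f.sum fun x a => g.sum fun y b => (x μ • a) * (y ν • b)) =
      (f.sum fun x a => x μ • a) * g.sum fun y b => y ν • b := by
    rw [Finsupp.sum_mul]; apply Finsupp.sum_congr; intro x _; rw [Finsupp.mul_sum]
  have e3 : (f.sum fun x a => g.sum fun y b => (x ν • a) * (y μ • b)) =
      (f.sum fun x a => x ν • a) * g.sum fun y b => y μ • b := by
    rw [Finsupp.sum_mul]; apply Finsupp.sum_congr; intro x _; rw [Finsupp.mul_sum]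
  have e4 : (f.sum fun x a => g.sum fun y b => a * ((y μ * y ν) • b)) =
      (f.sum fun x a => a) * g.sum fun y b => (y μ * y ν) • b := by
    rw [Finsupp.sum_mul]; apply Finsupp.sum_congr; intro x _; rw [Finsupp.mul_sum]
  rw [e1, e2, e3, e4]

/-! ## §3 Reflection, and the dressing theorem -/

/-- The reflected function `(reflect f)(x) = f(−x)` (the second dressing factor in `jᵀ ⋆ T ⋆ ǰ` is a reflection of
the first). [folklore] -/
noncomputable def reflect (f : LatFun d R) : LatFun d R := Finsupp.mapDomain (fun x => -x) f

/-- Moments of the reflection: the weight is composed with `x ↦ −x`. [folklore] -/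
theorem moment_reflect (φ : (Fin d → ℤ) → ℤ) (f : LatFun d R) :
    moment φ (reflect f) = moment (fun x => φ (-x)) f := by
  unfold moment reflect
  exact Finsupp.sum_mapDomain_index (fun _ => smul_zero _) (fun _ _ _ => smul_add _ _ _)

/-- Reflection preserves the zeroth moment. [folklore] -/
theorem M0_reflect (f : LatFun d R) : M0 (reflect f) = M0 f := by
  unfold M0; rw [moment_reflect]

/-- Reflection flips the first moments. [folklore] -/
theorem M1_reflect (μ : Fin d) (f : LatFun d R) : M1 μ (reflect f) = -M1 μ f := by
  unfold M1; rw [moment_reflect]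
  simp only [Pi.neg_apply, neg_smul, moment, Finsupp.sum_neg]

/-- Reflection preserves the second moments. [folklore] -/
theorem M2_reflect (μ ν : Fin d) (f : LatFun d R) : M2 μ ν (reflect f) = M2 μ ν f := by
  unfold M2; rw [moment_reflect]
  simp only [Pi.neg_apply, neg_mul_neg]

/-- One-sided dressing: `M2_{μν} (h ⋆ T) = M0 h · M2_{μν} T` when `M0 T = M1_μ T = M1_ν T = 0`. [folklore] -/
theorem M2_conv_of_vanishing (μ ν : Fin d) (h T : LatFun d R) (h0 : M0 T = 0) (h1 : M1 μ T = 0)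
    (h2 : M1 ν T = 0) : M2 μ ν (conv h T) = M0 h * M2 μ ν T := by
  rw [M2_conv, h0, h1, h2]
  simp

/-- Zeroth moment of a dressed kernel: `M0 (h ⋆ T ⋆ h′) = M0 h · M0 T · M0 h′`; in particular it vanishes with `M0 T`.
[folklore] -/
theorem M0_dressed (h T h' : LatFun d R) : M0 (conv (conv h T) h') = M0 h * M0 T * M0 h' := by
  rw [M0_conv, M0_conv]

/-- First moment of a dressed kernel when `M0 T = 0` and `M1_μ T = 0`: it vanishes again. [folklore] -/
theorem M1_dressed (μ : Fin d) (h T h' : LatFun d R) (h0 : M0 T = 0) (h1 : M1 μ T = 0) :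
    M1 μ (conv (conv h T) h') = 0 := by
  rw [M1_conv, M1_conv, M0_conv, h0, h1]
  simp

/-- **THE DRESSING THEOREM**: if the undressed kernel has vanishing zeroth moment (`M0 T = 0`, no mass term) and
vanishing first moments in the two directions (`M1_μ T = M1_ν T = 0`, e.g. by reflection symmetry), then the second
moment of the dressed kernel factorises: `M2_{μν} (h ⋆ T ⋆ h′) = M0 h · M2_{μν} T · M0 h′` — the dressing kernels enter
only through their zeroth moments. [folklore] -/
theorem M2_dressed (μ ν : Fin d) (h T h' : LatFun d R) (h0 : M0 T = 0) (h1 : M1 μ T = 0) (h2 : M1 ν T = 0) :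
    M2 μ ν (conv (conv h T) h') = M0 h * M2 μ ν T * M0 h' := by
  rw [M2_conv, M2_conv, M1_conv, M1_conv, M0_conv, h0, h1, h2]
  simp

/-- **The general two-sided dressing (nine terms)**: all distributions of the two moment weights among the three
factors of `h ⋆ T ⋆ h′` (values in a possibly noncommutative ring, so the ORDER of the factors is kept). [folklore] -/
theorem M2_dressed_nine (μ ν : Fin d) (h T h' : LatFun d R) :
    M2 μ ν (conv (conv h T) h') =
      M2 μ ν h * M0 T * M0 h' + M0 h * M2 μ ν T * M0 h' + M0 h * M0 T * M2 μ ν h'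
      + M1 μ h * M1 ν T * M0 h' + M1 ν h * M1 μ T * M0 h'
      + M0 h * M1 μ T * M1 ν h' + M0 h * M1 ν T * M1 μ h'
      + M1 μ h * M0 T * M1 ν h' + M1 ν h * M0 T * M1 μ h' := by
  rw [M2_conv, M2_conv, M1_conv, M1_conv, M0_conv]
  simp only [add_mul, mul_assoc]
  abel

/-- **The dressing under the WARD-TYPE hypotheses only** (`M0 h · M0 T = 0` and `M0 T · M0 h′ = 0`: the zeroth moment of
`T` kills the zeroth moments of the dressing kernels — e.g. `T` annihilates constants and `M0 h`, `M0 h′` are the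
constant patterns — WITHOUT assuming `M0 T = 0` or `M1 T = 0` outright): the second moment of `h ⋆ T ⋆ h′` is the MAIN TERM
`M0 h · M2 T · M0 h′` plus four cross terms pairing a first moment of `T` with a first moment of one dressing kernel,
plus two terms pairing `M0 T` with first moments of BOTH dressing kernels.  (In Fourier language at `p → 0`:
`ĵ₀* T̂₂ ĵ₀ + (ĵ₀* T̂₁ ĵ₁ + ĵ₁* T̂₁ ĵ₀) + ĵ₁* T̂₀ ĵ₁`.) [folklore] -/
theorem M2_dressed_ward (μ ν : Fin d) (h T h' : LatFun d R) (hl : M0 h * M0 T = 0) (hr : M0 T * M0 h' = 0) :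
    M2 μ ν (conv (conv h T) h') =
      M0 h * M2 μ ν T * M0 h'
      + (M1 μ h * M1 ν T * M0 h' + M1 ν h * M1 μ T * M0 h'
        + M0 h * M1 μ T * M1 ν h' + M0 h * M1 ν T * M1 μ h')
      + (M1 μ h * M0 T * M1 ν h' + M1 ν h * M0 T * M1 μ h') := by
  rw [M2_dressed_nine]
  have e1 : M2 μ ν h * M0 T * M0 h' = 0 := by rw [mul_assoc, hr, mul_zero]
  have e2 : M0 h * M0 T * M2 μ ν h' = 0 := by rw [hl, zero_mul]
  rw [e1, e2]
  abel

/-- Corollary: with UNIT zeroth moments of the dressing kernels (`M0 h = M0 h′ = 1`: constants are reproduced) the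
second moment is unchanged by the dressing. [folklore] -/
theorem M2_dressed_of_unit (μ ν : Fin d) (h T h' : LatFun d R) (h0 : M0 T = 0) (h1 : M1 μ T = 0)
    (h2 : M1 ν T = 0) (hh : M0 h = 1) (hh' : M0 h' = 1) :
    M2 μ ν (conv (conv h T) h') = M2 μ ν T := by
  rw [M2_dressed μ ν h T h' h0 h1 h2, hh, hh', one_mul, mul_one]

/-! ## §4 Link with the printed (1.22) second moment (`R = ℝ`, finitely supported kernels) -/

/-- For a finitely supported REAL lattice function the second moment `M2` is the plain sum `Σ_x f(x)·x_μ·x_ν`.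
[folklore] -/
theorem M2_eq_sum (μ ν : Fin d) (f : LatFun d ℝ) :
    M2 μ ν f = ∑ x ∈ f.support, f x * (x μ : ℝ) * (x ν : ℝ) := by
  simp only [M2, moment, Finsupp.sum, zsmul_eq_mul, Int.cast_mul]
  apply Finset.sum_congr rfl
  intro x _
  ring

/-- **The printed (1.22) moment for finitely supported kernels**: the `tsum` `Σ_x f(x) x_μ x_ν` over `ℤ^d`
(the shape of the tree's `B12Beta.secondMoment`, [Balaban1987RG1] (1.22)) equals `M2 μ ν f`. [folklore] -/
theorem tsum_eq_M2 (μ ν : Fin d) (f : LatFun d ℝ) :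
    ∑' x : Fin d → ℤ, f x * (x μ : ℝ) * (x ν : ℝ) = M2 μ ν f := by
  rw [M2_eq_sum, tsum_eq_sum]
  intro x hx
  rw [Finsupp.notMem_support_iff.mp hx, zero_mul, zero_mul]

/-! ## Examples -/

section Example

/-- The one-dimensional site `n`. [folklore] -/
private def pt (n : ℤ) : Fin 1 → ℤ := fun _ => n

/-- The lattice Laplacian stencil `T = δ₁ + δ₋₁ − 2δ₀` in one dimension. [folklore] -/
private noncomputable def T₁ : LatFun 1 ℝ :=
  Finsupp.single (pt 1) 1 + Finsupp.single (pt (-1)) 1 - Finsupp.single (pt 0) 2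

/-- The averaging kernel `h = ½(δ₀ + δ₁)` (zeroth moment one). [folklore] -/
private noncomputable def h₁ : LatFun 1 ℝ :=
  Finsupp.single (pt 0) (1 / 2) + Finsupp.single (pt 1) (1 / 2)

/-- `M0 T = 1 + 1 − 2 = 0`. [folklore] -/
private theorem T₁_M0 : M0 T₁ = 0 := by
  simp [M0, T₁, moment_add, moment_sub, moment_single]; norm_num

/-- `M1 T = 1 − 1 − 0 = 0`. [folklore] -/
private theorem T₁_M1 : M1 0 T₁ = 0 := by
  simp [M1, T₁, moment_add, moment_sub, moment_single, pt]

/-- `M2 T = 1 + 1 − 0 = 2`. [folklore] -/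
private theorem T₁_M2 : M2 0 0 T₁ = 2 := by
  simp [M2, T₁, moment_add, moment_sub, moment_single, pt]; norm_num

/-- `M0 h = ½ + ½ = 1`. [folklore] -/
private theorem h₁_M0 : M0 h₁ = 1 := by
  simp [M0, h₁, moment_add, moment_single]; norm_num

/-- `M0 T = 0`, `M1 T = 0`, `M2 T = 2`; dressing by `h` on both sides (`M0 h = 1`) leaves the second moment `2`.
[folklore] -/
example : M2 0 0 (conv (conv h₁ T₁) h₁) = 2 := by
  rw [M2_dressed_of_unit 0 0 h₁ T₁ h₁ T₁_M0 T₁_M1 T₁_M1 h₁_M0 h₁_M0, T₁_M2]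

end Example

end Literature.MathematicalPhysics.QuantumFieldTheory.Balaban1983to89.Beta.MomentFactorisation
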